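import Mathlib.Analysis.Calculus.Deriv.MeanValue
import Mathlib.Analysis.Calculus.Deriv.Inv
import Mathlib.Analysis.Calculus.Deriv.Pow
import Literature.Analysis.ValidatedNumerics.ParametricEigenScan
import HarnessLib

/-!
# The mean value form with a certified remainder for `RExpr` terms (symbolic partial derivatives,
# coordinate-wise Lagrange theorem, kernel-checkable first-order entry models)

Topic `Literature/Analysis/ValidatedNumerics`. The tree's term language `RExpr`
(`IntervalFunctions.lean`: `q | xᵢ | e₁ + e₂ | e₁ − e₂ | e₁ · e₂ | −e | e² | e⁻¹ | |e| | √e | min | max`)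
comes with the natural interval extension `RExpr.enclose` and its inclusion theorem (Moore 1966,
Thm. 3.1). A natural extension is ZERO-ORDER: the width of `[e](B)` is `O(w)` in the box half-width.
Krawczyk–Neumaier's MEAN VALUE FORM (Neumaier 1990 Thm. 2.3.3; Moore 1979 §4.4 eq. (4.19) (p. 43))
`e(x) ∈ e(c) + Σ_k [∂_k e](B) (x_k − c_k)` is first order: replacing the slope enclosures by point
slopes `a_k` leaves a remainder `Σ_k w_k · dev([∂_k e](B), a_k) = O(w²)`. This file makes that form
KERNEL-CHECKABLE for the rational sub-language (`q, xᵢ, +, −, ×, −·, ·², ·⁻¹`):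

* `RExpr.pderiv k e` — the symbolic partial derivative `∂e/∂x_k`, a term of the same language;
  `RExpr.smooth e` (no `|·|, √, min, max`), `RExpr.varsLT K e` (only the variables `x_0 … x_{K−1}`);
* `RExpr.hasDerivAt_eval_update` — if `e` is smooth and `RExpr.enclose` SUCCEEDS on a box (so no
  reciprocal of an interval containing `0` occurs) then, at every point `x` of the box and along every
  coordinate `k`, `t ↦ e(x; x_k := t)` has derivative `(pderiv k e)(x)` (structural induction with
  Mathlib's `HasDerivAt` calculus);
* `RExpr.abs_eval_update_sub_le` — ONE COORDINATE STEP: for `z` in the box and two values `t₁, t₂` of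
  coordinate `k`'s interval, `|e(z; t₂) − e(z; t₁) − a (t₂ − t₁)| ≤ |t₂ − t₁| · dev([∂_k e](B), a)`
  (Lagrange, Mathlib `exists_hasDerivAt_eq_slope`, the derivative value lying in the enclosure);
* **`RExpr.abs_eval_sub_centredForm_le`** — THE MEAN VALUE FORM WITH REMAINDER on a box `B` with
  rational centre `c = Box.cen` and half-widths `w = Box.hw`: for ANY rational slopes `a_k`,
  `|e(x) − e(c) − Σ_{k<K} a_k (x_k − c_k)| ≤ Σ_{k<K} w_k · dev([∂_k e](B), a_k)` — proved along the
  coordinate STAIRCASE `c → (x₀, c₁, …) → (x₀, x₁, c₂, …) → … → x`, which stays in the box, so that no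
  multivariate calculus is needed; `RExpr.abs_eval_cen_sub_le` bounds `|e(c) − a₀|` by the point
  enclosure;
* `RExpr.affRemQ`, **`RExpr.affEntryOK K prec iters e B a₀ a R`** (computable, kernel-reducible) and
  **`RExpr.affEntryOK_sound`**: `|e(x) − (a₀ + Σ_{k<K} a_k (x_k − c_k))| ≤ R` for every `x` of `B`;
* `Box.cen`, `Box.hw` (rational centre / half-width of a box coordinate; private box bookkeeping lemmas).

`dev(I, a) = max |I.lo − a| |I.hi − a|` is `devQ` (`ParametricEigenScan.lean`). Consumer: the piecewise-affine
Lyapunov certificates for `RExpr` matrix families (`ParametricLyapunovRexprCertificate.lean`). NOT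
here: derivatives of `|·|, √, min, max` (refused by `smooth`), second-order forms; the record file
`MeanValueForm.lean` types Neumaier's Theorem 2.3.3 itself — this file proves only the elementary
remainder inequality it needs. Everything here is proved; no named facts.
-/

noncomputable section

open Finset Matrix NonemptyInterval Set

namespace Literature.Analysis.ValidatedNumerics

namespace RExpr

/-! ### Symbolic partial derivatives of `RExpr` terms -/

/-- The symbolic partial derivative `∂e/∂x_k` of a term built from the rational operations (on the
non-smooth constructors `|·|, √, min, max` it returns the junk term `0`; those are excluded by
`smooth`). [folklore] -/
def pderiv (k : ℕ) : RExpr → RExpr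
  | const _ => const 0
  | var i => if i = k then const 1 else const 0
  | add e₁ e₂ => add (pderiv k e₁) (pderiv k e₂)
  | sub e₁ e₂ => sub (pderiv k e₁) (pderiv k e₂)
  | mul e₁ e₂ => add (mul (pderiv k e₁) e₂) (mul e₁ (pderiv k e₂))
  | neg e => neg (pderiv k e)
  | sq e => mul (const 2) (mul e (pderiv k e))
  | inv e => neg (mul (pderiv k e) (sq (inv e)))
  | abs _ => const 0
  | sqrt _ => const 0
  | min _ _ => const 0
  | max _ _ => const 0

/-- A term uses only the rational operations `q, xᵢ, +, −, ×, −·, ·², ·⁻¹` (no `|·|, √, min, max`).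
[folklore] -/
def smooth : RExpr → Bool
  | const _ => true
  | var _ => true
  | add e₁ e₂ => smooth e₁ && smooth e₂
  | sub e₁ e₂ => smooth e₁ && smooth e₂
  | mul e₁ e₂ => smooth e₁ && smooth e₂
  | neg e => smooth e
  | sq e => smooth e
  | inv e => smooth e
  | abs _ => false
  | sqrt _ => false
  | min _ _ => false
  | max _ _ => false

/-- Every variable index of the term is `< K`. [folklore] -/
def varsLT (K : ℕ) : RExpr → Bool
  | const _ => true
  | var i => decide (i < K)
  | add e₁ e₂ => varsLT K e₁ && varsLT K e₂
  | sub e₁ e₂ => varsLT K e₁ && varsLT K e₂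
  | mul e₁ e₂ => varsLT K e₁ && varsLT K e₂
  | neg e => varsLT K e
  | sq e => varsLT K e
  | inv e => varsLT K e
  | abs e => varsLT K e
  | sqrt e => varsLT K e
  | min e₁ e₂ => varsLT K e₁ && varsLT K e₂
  | max e₁ e₂ => varsLT K e₁ && varsLT K e₂

/-- A term with variables `< K` takes the same value at points agreeing on the coordinates `< K`.
[folklore] -/
private theorem eval_congr_of_varsLT {K : ℕ} {x y : ℕ → ℝ} (hxy : ∀ i < K, x i = y i) (e : RExpr)
    (h : varsLT K e = true) : e.eval x = e.eval y := by
  induction e with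
  | const q => rfl
  | var i =>
    simp only [varsLT, decide_eq_true_eq] at h
    exact hxy i h
  | add e₁ e₂ ih₁ ih₂ | sub e₁ e₂ ih₁ ih₂ | mul e₁ e₂ ih₁ ih₂ | min e₁ e₂ ih₁ ih₂ | max e₁ e₂ ih₁ ih₂ =>
    simp only [varsLT, Bool.and_eq_true] at h
    simp only [eval, ih₁ h.1, ih₂ h.2]
  | neg e ih | sq e ih | inv e ih | abs e ih | sqrt e ih => simp only [eval, ih h]

/-- An interval on which `invI?` succeeds does not contain `0`. [cite: Moore1966, Ch. 3] -/
private theorem ne_zero_of_invI?' {I J : NonemptyInterval ℚ} (hJ : I.invI? = some J) {x : ℝ}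
    (hx : x ∈ I.ratCast ℝ) : x ≠ 0 := by
  rw [mem_ratCast_iff] at hx
  unfold NonemptyInterval.invI? at hJ
  split_ifs at hJ with ha hb
  · have : (0 : ℝ) < I.fst := by exact_mod_cast ha
    exact (this.trans_le hx.1).ne'
  · have : (I.snd : ℝ) < 0 := by exact_mod_cast hb
    exact (hx.2.trans_lt this).ne

/-- **Differentiability along a coordinate, with the symbolic derivative.** If `e` is smooth and its
natural interval extension succeeds on the box `X` (so every reciprocal is of a term that does not
vanish on `X`), then for every point `x` of `X` and every coordinate `k`, the one-variable function
`t ↦ e(x with x_k := t)` has derivative `(pderiv k e)(x)` at `t = x_k`. [cite: Moore1979, §3.4 and §4.4 (D_iT rules, p. 44)] -/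
theorem hasDerivAt_eval_update {prec iters : ℕ} {X : ℕ → NonemptyInterval ℚ} {x : ℕ → ℝ}
    (hx : ∀ i, x i ∈ (X i).ratCast ℝ) (k : ℕ) :
    ∀ e : RExpr, smooth e = true → (∃ I, e.enclose prec iters X = some I) →
      HasDerivAt (fun t ↦ e.eval (Function.update x k t)) ((pderiv k e).eval x) (x k)
  | const q, _, _ => by simpa only [eval, pderiv, Rat.cast_zero] using hasDerivAt_const _ _
  | var i, _, _ => by
    by_cases hik : i = k
    · subst hik
      simp only [eval, pderiv, if_true, Function.update_self, Rat.cast_one]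
      exact hasDerivAt_id _
    · simp only [eval, pderiv, if_neg hik, Function.update_of_ne hik, Rat.cast_zero]
      exact hasDerivAt_const _ _
  | add e₁ e₂, hs, ⟨I, hI⟩ => by
    simp only [smooth, Bool.and_eq_true] at hs
    obtain ⟨A, B, hA, hB, -⟩ := obind₂_eq_some_iff.1 hI
    simp only [eval, pderiv]
    exact (hasDerivAt_eval_update hx k e₁ hs.1 ⟨A, hA⟩).add (hasDerivAt_eval_update hx k e₂ hs.2 ⟨B, hB⟩)
  | sub e₁ e₂, hs, ⟨I, hI⟩ => by
    simp only [smooth, Bool.and_eq_true] at hs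
    obtain ⟨A, B, hA, hB, -⟩ := obind₂_eq_some_iff.1 hI
    simp only [eval, pderiv]
    exact (hasDerivAt_eval_update hx k e₁ hs.1 ⟨A, hA⟩).sub (hasDerivAt_eval_update hx k e₂ hs.2 ⟨B, hB⟩)
  | mul e₁ e₂, hs, ⟨I, hI⟩ => by
    simp only [smooth, Bool.and_eq_true] at hs
    obtain ⟨A, B, hA, hB, -⟩ := obind₂_eq_some_iff.1 hI
    simp only [eval, pderiv]
    have h := (hasDerivAt_eval_update hx k e₁ hs.1 ⟨A, hA⟩).mul (hasDerivAt_eval_update hx k e₂ hs.2 ⟨B, hB⟩)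
    simp only [Function.update_eq_self] at h
    exact h
  | neg e, hs, ⟨I, hI⟩ => by
    obtain ⟨A, hA, -⟩ := Option.map_eq_some_iff.1 hI
    exact (hasDerivAt_eval_update hx k e hs ⟨A, hA⟩).neg
  | sq e, hs, ⟨I, hI⟩ => by
    simp only [smooth] at hs
    obtain ⟨A, hA, -⟩ := Option.map_eq_some_iff.1 hI
    simp only [eval, pderiv, Rat.cast_ofNat]
    have h := (hasDerivAt_eval_update hx k e hs ⟨A, hA⟩).fun_pow 2
    simp only [Function.update_eq_self, Nat.cast_ofNat] at h
    refine h.congr_deriv ?_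
    norm_num
    ring
  | inv e, hs, ⟨I, hI⟩ => by
    simp only [smooth] at hs
    obtain ⟨A, hA, h2⟩ := Option.bind_eq_some_iff.1 hI
    obtain ⟨J, hJ, -⟩ := Option.map_eq_some_iff.1 h2
    have hne : e.eval x ≠ 0 := ne_zero_of_invI?' hJ (eval_mem_enclose hx e hA)
    simp only [eval, pderiv]
    have h := (hasDerivAt_eval_update hx k e hs ⟨A, hA⟩).fun_inv (by simpa only [Function.update_eq_self] using hne)
    simp only [Function.update_eq_self] at h
    refine h.congr_deriv ?_
    rw [inv_pow]
    ring
  | abs _, hs, _ | sqrt _, hs, _ | min _ _, hs, _ | max _ _, hs, _ => by simp [smooth] at hs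

/-! ### The mean value form along a coordinate staircase -/

/-- Replacing coordinate `k` of a point of the box by a value of that coordinate's interval stays in
the box. [folklore] -/
private theorem _root_.Literature.Analysis.ValidatedNumerics.Box.mem_update {B : Box} {z : ℕ → ℝ}
    (hz : B.mem z) (k : ℕ) {t : ℝ} (ht : ((B.ivl k).1 : ℝ) ≤ t ∧ t ≤ ((B.ivl k).2 : ℝ)) :
    B.mem (Function.update z k t) := by
  intro i
  by_cases hik : i = k
  · subst hik; rw [Function.update_self]; exact ht
  · rw [Function.update_of_ne hik]; exact hz i

/-- **One coordinate step of the mean value form**: for a point `z` of the box, two values `t₁, t₂`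
of coordinate `k`'s interval and any rational slope `a`,
`|e(z; x_k := t₂) − e(z; x_k := t₁) − a (t₂ − t₁)| ≤ |t₂ − t₁| · dev([∂_k e](B), a)` — Lagrange's
theorem on the segment, the derivative value lying in the kernel's enclosure of `pderiv k e` on the
box. [cite: Moore1979, §4.4 eq. (4.19) (p. 43)] -/
theorem abs_eval_update_sub_le {prec iters : ℕ} {B : Box} {z : ℕ → ℝ} (hz : B.mem z) (k : ℕ)
    (e : RExpr) (hs : smooth e = true) (he : ∃ I, e.enclose prec iters B.toIvl = some I)
    {G : NonemptyInterval ℚ} (hG : (pderiv k e).enclose prec iters B.toIvl = some G) (a : ℚ)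
    {t₁ t₂ : ℝ} (ht₁ : ((B.ivl k).1 : ℝ) ≤ t₁ ∧ t₁ ≤ ((B.ivl k).2 : ℝ))
    (ht₂ : ((B.ivl k).1 : ℝ) ≤ t₂ ∧ t₂ ≤ ((B.ivl k).2 : ℝ)) :
    |e.eval (Function.update z k t₂) - e.eval (Function.update z k t₁) - (a : ℝ) * (t₂ - t₁)|
      ≤ |t₂ - t₁| * (devQ G a : ℝ) := by
  set f : ℝ → ℝ := fun t ↦ e.eval (Function.update z k t) with hf
  set f' : ℝ → ℝ := fun t ↦ (pderiv k e).eval (Function.update z k t) with hf'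
  -- derivative of `f` at every point of the coordinate interval
  have hder : ∀ t : ℝ, ((B.ivl k).1 : ℝ) ≤ t ∧ t ≤ ((B.ivl k).2 : ℝ) → HasDerivAt f (f' t) t := by
    intro t ht
    have hmem := Box.mem_update hz k ht
    have h := hasDerivAt_eval_update (prec := prec) (iters := iters) (X := B.toIvl)
      (x := Function.update z k t) (fun i ↦ Box.mem_toIvl hmem i) k e hs he
    simp only [Function.update_idem, Function.update_self] at h
    exact h
  -- the derivative values lie in `G`
  have hG' : ∀ t : ℝ, ((B.ivl k).1 : ℝ) ≤ t ∧ t ≤ ((B.ivl k).2 : ℝ) → |f' t - a| ≤ (devQ G a : ℝ) := by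
    intro t ht
    exact abs_sub_le_devQ (eval_mem_enclose (fun i ↦ Box.mem_toIvl (Box.mem_update hz k ht) i) _ hG)
  -- Lagrange on the segment between `t₁` and `t₂` (either order), or the trivial case `t₁ = t₂`
  have key : ∃ ξ : ℝ, (((B.ivl k).1 : ℝ) ≤ ξ ∧ ξ ≤ ((B.ivl k).2 : ℝ)) ∧ f t₂ - f t₁ = f' ξ * (t₂ - t₁) := by
    rcases lt_trichotomy t₁ t₂ with hlt | heq | hgt
    · have hcont : ContinuousOn f (Icc t₁ t₂) := fun t ht ↦
        (hder t ⟨ht₁.1.trans ht.1, ht.2.trans ht₂.2⟩).continuousAt.continuousWithinAt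
      obtain ⟨ξ, hξ, hξ'⟩ := exists_hasDerivAt_eq_slope f f' hlt hcont
        (fun t ht ↦ hder t ⟨ht₁.1.trans ht.1.le, ht.2.le.trans ht₂.2⟩)
      refine ⟨ξ, ⟨ht₁.1.trans hξ.1.le, hξ.2.le.trans ht₂.2⟩, ?_⟩
      rw [hξ', div_mul_cancel₀ _ (sub_ne_zero.2 hlt.ne')]
    · subst heq; exact ⟨t₁, ht₁, by simp⟩
    · have hcont : ContinuousOn f (Icc t₂ t₁) := fun t ht ↦
        (hder t ⟨ht₂.1.trans ht.1, ht.2.trans ht₁.2⟩).continuousAt.continuousWithinAt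
      obtain ⟨ξ, hξ, hξ'⟩ := exists_hasDerivAt_eq_slope f f' hgt hcont
        (fun t ht ↦ hder t ⟨ht₂.1.trans ht.1.le, ht.2.le.trans ht₁.2⟩)
      refine ⟨ξ, ⟨ht₂.1.trans hξ.1.le, hξ.2.le.trans ht₁.2⟩, ?_⟩
      have e1 : f t₁ - f t₂ = f' ξ * (t₁ - t₂) := by
        rw [hξ', div_mul_cancel₀ _ (sub_ne_zero.2 hgt.ne')]
      linarith
  obtain ⟨ξ, hξ, hfe⟩ := key
  have e2 : e.eval (Function.update z k t₂) - e.eval (Function.update z k t₁) - (a : ℝ) * (t₂ - t₁)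
      = (f' ξ - a) * (t₂ - t₁) := by
    show f t₂ - f t₁ - (a : ℝ) * (t₂ - t₁) = _
    rw [hfe]; ring
  rw [e2, abs_mul, mul_comm]
  exact mul_le_mul_of_nonneg_left (hG' ξ hξ) (abs_nonneg _)

end RExpr

/-- The rational centre of coordinate `i` of a box. [folklore] -/
def Box.cen (B : Box) (i : ℕ) : ℚ := ((B.ivl i).1 + (B.ivl i).2) / 2

/-- The rational half-width of coordinate `i` of a box. [folklore] -/
def Box.hw (B : Box) (i : ℕ) : ℚ := ((B.ivl i).2 - (B.ivl i).1) / 2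

/-- The centre of a box that has a point lies in the box. [folklore] -/
private theorem Box.mem_cen {B : Box} {x : ℕ → ℝ} (hx : B.mem x) : B.mem fun i ↦ ((B.cen i : ℚ) : ℝ) := by
  intro i
  have h := hx i
  unfold Box.cen; push_cast
  constructor <;> linarith [h.1, h.2]

/-- A point of the box is within the half-width of the centre, coordinatewise. [folklore] -/
private theorem Box.abs_sub_cen_le {B : Box} {x : ℕ → ℝ} (hx : B.mem x) (i : ℕ) :
    |x i - ((B.cen i : ℚ) : ℝ)| ≤ ((B.hw i : ℚ) : ℝ) := by
  have h := hx i
  unfold Box.cen Box.hw; push_cast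
  rw [abs_le]; constructor <;> linarith [h.1, h.2]

namespace RExpr

/-- **THE MEAN VALUE FORM WITH A CERTIFIED REMAINDER** (box version). If `e` is smooth, uses only
the variables `x_0 … x_{K−1}`, and the kernel's interval extensions of `e` and of every `pderiv k e`
succeed on the box `B` (centre `c`, half-widths `w`), then for ANY rational slopes `a_k` and every
`x` of `B`: `|e(x) − e(c) − Σ_{k<K} a_k (x_k − c_k)| ≤ Σ_{k<K} w_k · dev([∂_k e](B), a_k)`.
Proof: the coordinate staircase `c → (x_0, c_1, …) → (x_0, x_1, c_2, …) → … → x` stays in the box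
and each step is `abs_eval_update_sub_le`. [cite: Moore1979, §4.4 eq. (4.19) (p. 43); Neumaier1991, Thm. 2.3.3] -/
theorem abs_eval_sub_centredForm_le {prec iters K : ℕ} {B : Box} (e : RExpr) (hv : varsLT K e = true)
    (hs : smooth e = true) (he : ∃ I, e.enclose prec iters B.toIvl = some I)
    (G : ℕ → NonemptyInterval ℚ) (hG : ∀ k < K, (pderiv k e).enclose prec iters B.toIvl = some (G k))
    (a : ℕ → ℚ) {x : ℕ → ℝ} (hx : B.mem x) :
    |e.eval x - e.eval (fun i ↦ ((B.cen i : ℚ) : ℝ)) - ∑ k ∈ range K, (a k : ℝ) * (x k - ((B.cen k : ℚ) : ℝ))|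
      ≤ ∑ k ∈ range K, ((B.hw k : ℚ) : ℝ) * (devQ (G k) (a k) : ℝ) := by
  -- the staircase points
  let y : ℕ → ℕ → ℝ := fun m i ↦ if i < m then x i else ((B.cen i : ℚ) : ℝ)
  have hy_mem : ∀ m, B.mem (y m) := fun m i ↦ by
    by_cases him : i < m
    · simp only [y, if_pos him]; exact hx i
    · simp only [y, if_neg him]; exact Box.mem_cen hx i
  have hy0 : y 0 = fun i ↦ ((B.cen i : ℚ) : ℝ) := by
    funext i; simp [y]
  have hyK : e.eval (y K) = e.eval x :=
    eval_congr_of_varsLT (fun i hi ↦ by simp only [y, if_pos hi]) e hv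
  have hstep : ∀ m, y (m + 1) = Function.update (y m) m (x m) := by
    intro m; funext i
    by_cases him : i = m
    · subst him; simp [y]
    · rw [Function.update_of_ne him]
      by_cases hlt : i < m
      · simp [y, hlt, Nat.lt_succ_of_lt hlt]
      · have : ¬ i < m + 1 := fun h ↦ him (by omega)
        simp [y, hlt, this]
  have hsame : ∀ m, y m = Function.update (y m) m ((B.cen m : ℚ) : ℝ) := by
    intro m
    have : y m m = ((B.cen m : ℚ) : ℝ) := by simp [y]
    rw [← this, Function.update_eq_self]
  -- induction along the staircase
  have main : ∀ m ≤ K, |e.eval (y m) - e.eval (y 0) - ∑ k ∈ range m, (a k : ℝ) * (x k - ((B.cen k : ℚ) : ℝ))|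
      ≤ ∑ k ∈ range m, ((B.hw k : ℚ) : ℝ) * (devQ (G k) (a k) : ℝ) := by
    intro m
    induction m with
    | zero => intro _; simp
    | succ m ih =>
      intro hm
      have hmK : m < K := Nat.lt_of_succ_le hm
      have h1 := ih hmK.le
      have hcm := Box.mem_cen hx m
      have h2 := abs_eval_update_sub_le (hy_mem m) m e hs he (hG m hmK) (a m) hcm (hx m)
      rw [← hsame m, ← hstep m] at h2
      have h3 : |x m - ((B.cen m : ℚ) : ℝ)| * (devQ (G m) (a m) : ℝ)
          ≤ ((B.hw m : ℚ) : ℝ) * (devQ (G m) (a m) : ℝ) := by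
        refine mul_le_mul_of_nonneg_right (Box.abs_sub_cen_le hx m) ?_
        unfold devQ; push_cast; positivity
      rw [sum_range_succ, sum_range_succ]
      calc |e.eval (y (m + 1)) - e.eval (y 0)
              - (∑ k ∈ range m, (a k : ℝ) * (x k - ((B.cen k : ℚ) : ℝ)) + (a m : ℝ) * (x m - ((B.cen m : ℚ) : ℝ)))|
          = |(e.eval (y (m + 1)) - e.eval (y m) - (a m : ℝ) * (x m - ((B.cen m : ℚ) : ℝ)))
              + (e.eval (y m) - e.eval (y 0) - ∑ k ∈ range m, (a k : ℝ) * (x k - ((B.cen k : ℚ) : ℝ)))| := by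
            ring_nf
        _ ≤ |e.eval (y (m + 1)) - e.eval (y m) - (a m : ℝ) * (x m - ((B.cen m : ℚ) : ℝ))|
              + |e.eval (y m) - e.eval (y 0) - ∑ k ∈ range m, (a k : ℝ) * (x k - ((B.cen k : ℚ) : ℝ))| :=
            abs_add_le _ _
        _ ≤ ((B.hw m : ℚ) : ℝ) * (devQ (G m) (a m) : ℝ)
              + ∑ k ∈ range m, ((B.hw k : ℚ) : ℝ) * (devQ (G k) (a k) : ℝ) := add_le_add (h2.trans h3) h1
        _ = ∑ k ∈ range m, ((B.hw k : ℚ) : ℝ) * (devQ (G k) (a k) : ℝ)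
              + ((B.hw m : ℚ) : ℝ) * (devQ (G m) (a m) : ℝ) := add_comm _ _
  have h := main K le_rfl
  rwa [hyK, hy0] at h

/-- The value at the rational centre lies in the kernel's point enclosure. [cite: Moore1966, Theorem 3.1] -/
theorem abs_eval_cen_sub_le {prec iters : ℕ} {B : Box} (e : RExpr) {I0 : NonemptyInterval ℚ}
    (hI0 : e.enclose prec iters (fun i ↦ pure (B.cen i)) = some I0) (a0 : ℚ) :
    |e.eval (fun i ↦ ((B.cen i : ℚ) : ℝ)) - (a0 : ℝ)| ≤ (devQ I0 a0 : ℝ) :=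
  abs_sub_le_devQ (eval_mem_enclose (X := fun i ↦ pure (B.cen i))
    (fun i ↦ by rw [ratCast_pure]; exact mem_pure_self _) e hI0)

/-! ### The computable entry check -/

/-- The certified first-order remainder of `e` on `B` for centre value `a0` and slopes `a`:
`dev(E(c), a0) + Σ_{k<K} w_k · dev([∂_k e](B), a_k)` (enclosures that fail contribute junk; the check
`affEntryOK` requires them all to succeed). [cite: Moore1979, §4.4 eq. (4.19) (p. 43)] -/
def affRemQ (K prec iters : ℕ) (e : RExpr) (B : Box) (a0 : ℚ) (a : ℕ → ℚ) : ℚ :=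
  devQ ((e.enclose prec iters fun i ↦ pure (B.cen i)).getD (pure 0)) a0
    + rsum K fun k ↦ B.hw k * devQ (((pderiv k e).enclose prec iters B.toIvl).getD (pure 0)) (a k)

/-- **Entry check**: `e` is smooth with variables `< K`, all the kernel's enclosures succeed, and the
certified remainder is `≤ R`. [cite: Moore1979, §4.4 eq. (4.19) (p. 43)] -/
def affEntryOK (K prec iters : ℕ) (e : RExpr) (B : Box) (a0 : ℚ) (a : ℕ → ℚ) (R : ℚ) : Bool :=
  smooth e && varsLT K e && (e.enclose prec iters B.toIvl).isSome
    && (e.enclose prec iters fun i ↦ pure (B.cen i)).isSome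
    && (rall K fun k ↦ ((pderiv k e).enclose prec iters B.toIvl).isSome)
    && decide (affRemQ K prec iters e B a0 a ≤ R)

/-- **Soundness of the entry check**: the affine model `a0 + Σ_{k<K} a_k (x_k − c_k)` is within `R`
of `e(x)` at every point of the box. [cite: Moore1979, §4.4 eq. (4.19) (p. 43); Neumaier1991, Thm. 2.3.3] -/
theorem affEntryOK_sound {K prec iters : ℕ} {e : RExpr} {B : Box} {a0 : ℚ} {a : ℕ → ℚ} {R : ℚ}
    (h : affEntryOK K prec iters e B a0 a R = true) {x : ℕ → ℝ} (hx : B.mem x) :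
    |e.eval x - ((a0 : ℝ) + ∑ k ∈ range K, (a k : ℝ) * (x k - ((B.cen k : ℚ) : ℝ)))| ≤ (R : ℝ) := by
  unfold affEntryOK at h
  simp only [Bool.and_eq_true, decide_eq_true_eq, Option.isSome_iff_exists] at h
  obtain ⟨⟨⟨⟨⟨hs, hv⟩, ⟨I, hI⟩⟩, ⟨I0, hI0⟩⟩, hall⟩, hR⟩ := h
  have hG : ∀ k < K, ∃ G, (pderiv k e).enclose prec iters B.toIvl = some G := fun k hk ↦ by
    have := of_rall hall hk
    exact Option.isSome_iff_exists.1 this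
  choose! G hG using hG
  have h1 := abs_eval_sub_centredForm_le e hv hs ⟨I, hI⟩ G hG a hx
  have h2 := abs_eval_cen_sub_le e hI0 a0
  have hrem : (devQ I0 a0 : ℝ) + ∑ k ∈ range K, ((B.hw k : ℚ) : ℝ) * (devQ (G k) (a k) : ℝ) ≤ (R : ℝ) := by
    have e1 : affRemQ K prec iters e B a0 a = devQ I0 a0 + ∑ k ∈ range K, B.hw k * devQ (G k) (a k) := by
      unfold affRemQ
      rw [hI0, Option.getD_some, rsum_eq_sum]
      congr 1
      exact sum_congr rfl fun k hk ↦ by rw [hG k (mem_range.1 hk), Option.getD_some]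
    have := hR; rw [e1] at this
    exact_mod_cast this
  calc |e.eval x - ((a0 : ℝ) + ∑ k ∈ range K, (a k : ℝ) * (x k - ((B.cen k : ℚ) : ℝ)))|
      = |(e.eval x - e.eval (fun i ↦ ((B.cen i : ℚ) : ℝ)) - ∑ k ∈ range K, (a k : ℝ) * (x k - ((B.cen k : ℚ) : ℝ)))
          + (e.eval (fun i ↦ ((B.cen i : ℚ) : ℝ)) - (a0 : ℝ))| := by ring_nf
    _ ≤ _ := abs_add_le _ _
    _ ≤ (∑ k ∈ range K, ((B.hw k : ℚ) : ℝ) * (devQ (G k) (a k) : ℝ)) + (devQ I0 a0 : ℝ) := add_le_add h1 h2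
    _ ≤ (R : ℝ) := by linarith

end RExpr

end Literature.Analysis.ValidatedNumerics
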